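import Summits.PneNP.GCT.Certificates.PerDetHwvCertificateTwelveNineteenSeven
import Literature.Computability.AlgebraicComplexity.LMRDetThreeIdealModuleHolds
import Literature.Computability.AlgebraicComplexity.LMR13KroneckerMultiplicitySix
import HarnessLib

/-!
# The Landsberg–Manivel–Ressayre row `(3,3)`, `λ = (19,7,2,2,2,2,2) ⊢ 36`, UNCONDITIONALLY

The certificate files `PerDetHwvCertificateTwelveNineteenSeven.lean` (permanent side, kernel bound
`6 ≤ mult_{λ^*} ℂ[Δ(per₃)]₁₂`) and `PerDetHwvCertificateTwelveNineteenSevenDet.lean` (determinant side,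
kernel bound `5 ≤ mult_{λ^*} ℂ[Δ(det₃)]₁₂`) of cell `pub-gct` state the complete reading of the row
CONDITIONALLY on two hypotheses:

* `(h : LMR2013_detThree_idealHwv)` — Landsberg–Manivel–Ressayre 2013, Thm. 1.1.2 (1) with §3.2 at
  `n = 3`: a nonzero highest-weight vector of weight `λ^*` in the ideal of `Δ(det₃)` in degree 12;
  now the tree theorem `LMR2013_detThree_idealHwv_holds` (`LMRDetThreeIdealModuleHolds.lean`,
  from `LMR2013_thm_1_1_2_1_holds`);
* `(ha : a_λ(12[3]) ≤ 6)` — LMR §3.2 (p. 476) "the module `12ω₁ + 5ω₂ + 2ω₇` occurs with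
  multiplicity six in `S¹²(S³ℂ⁹)`"; now the tree theorem `plethysmCoeff_lmrPartitionThree_le`
  (indeed `plethysmCoeff_lmrPartitionThree : … = 6`, `LMR13KroneckerMultiplicitySix.lean`, a kernel
  evaluation of the DIP20 (4.4) signed monomial-count formula).

This file (a NEW file; no file of `pub-gct` is edited, provenance stays one-directional) instantiates
the five conditional theorems at these two discharges, so that the row is a list of hypothesis-free
kernel theorems, all in the tree's dual-weight convention `λ^* = (Weight.dualOfPartition 9 λ).toMatIdx`:

* `perThree_lmr_exact` — `mult_{λ^*} ℂ[Δ(per₃)]₁₂ = 6`, `a_λ(12[3]) = 6`, and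
  `dim (HWV_{λ^*} ∩ I(Δ(per₃))₁₂) = 0` (no type-`λ` equation for `per₃` in degree 12);
* `detThree_lmr_exact` — `mult_{λ^*} ℂ[Δ(det₃)]₁₂ + 1 = a_λ` and
  `dim (HWV_{λ^*} ∩ I(Δ(det₃))₁₂) = 1` ("only one copy of it is in the ideal", LMR §3.2, DERIVED);
* `orbitMultiplicity_detThree_lmr_eq_five` — `mult_{λ^*} ℂ[Δ(det₃)]₁₂ = 5`;
* `perDet_lmr_exact` — `mult_det + 1 = a_λ ≤ mult_per` and
  `PerDetMultiplicityObstructionAt 3 3 12 lmrPartitionThree`;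
* `perDet_lmr_five_six` — the numerical summary `mult_det = 5 ∧ mult_per = 6`;
* `lmr_threeThree_row` — everything in one conjunction.

Honest framing (cells `pub-gct` / `val-lit`): `(n, m) = (3, 3)` is a VALIDATION row at a known
separation (`per₃ ∉ Δ(det₃) = GL₉ · det₃` closure is Landsberg–Manivel–Ressayre Thm. 1.1.1 territory);
the content is the representation-theoretic datum `5 < 6`, now certified end-to-end inside the kernel
(two rank certificates + one plethysm evaluation + the LMR weight-vector construction). Nothing here is
a claim about VP ≠ VNP or P ≠ NP, which are NOT proved. [folklore] bookkeeping; sources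
[LandsbergManivelRessayre2013] Thm. 1.1.2 (1) (p. 470), §3.2 (p. 476); [BurgisserIkenmeyer2013] §4–§5.
-/


namespace Summit.PneNP.GCT

open Literature.Computability.AlgebraicComplexity
open _root_.Literature.NumberTheory.DiophantineGeometry

/-- **Permanent side of the LMR row, unconditionally**: `mult_{λ^*} ℂ[Δ(per₃)]₁₂ = 6`,
`a_λ(12[3]) = 6`, and the space of type-`λ` equations of `per₃` in degree 12 is zero
(`λ = lmrPartitionThree = (19,7,2^5)`). Instance of `perThree_lmr_exact_of_le` at
`plethysmCoeff_lmrPartitionThree_le`. [cite: LandsbergManivelRessayre2013, §3.2 (p. 476)] -/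
theorem perThree_lmr_exact :
    orbitMultiplicity ℂ (paddedPerFormLex ℂ 3 3) 3
          (Weight.dualOfPartition (3 * 3) lmrPartitionThree).toMatIdx = 6 ∧
      plethysmCoeff ℂ (MatIdx 3) 3 (Weight.dualOfPartition (3 * 3) lmrPartitionThree).toMatIdx = 6 ∧
      Module.finrank ℂ ↥(highestWeightSpace (coordRep (MatIdx 3) ℂ 3)
            (Weight.dualOfPartition (3 * 3) lmrPartitionThree).toMatIdx ⊓
          (orbitVanishingIdeal (paddedPerFormLex ℂ 3 3) 3).restrictScalars ℂ) = 0 :=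
  perThree_lmr_exact_of_le plethysmCoeff_lmrPartitionThree_le

/-- **Determinant side of the LMR row, unconditionally**: `mult_{λ^*} ℂ[Δ(det₃)]₁₂ + 1 = a_λ(12[3])`
and `dim (HWV_{λ^*}(ℂ[Sym³ℂ⁹]₁₂) ∩ I(Δ(det₃))) = 1` — "only one copy of it is in the ideal"
(LMR 2013 §3.2, p. 476), here a kernel theorem. Instance of `detThree_lmr_exact_of_LMR` at
`LMR2013_detThree_idealHwv_holds` and `plethysmCoeff_lmrPartitionThree_le`.
[cite: LandsbergManivelRessayre2013, §3.2 (p. 476)] -/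
theorem detThree_lmr_exact :
    orbitMultiplicity ℂ (detFormLex ℂ 3) 3
          (Weight.dualOfPartition (3 * 3) lmrPartitionThree).toMatIdx + 1 =
        plethysmCoeff ℂ (MatIdx 3) 3 (Weight.dualOfPartition (3 * 3) lmrPartitionThree).toMatIdx ∧
      Module.finrank ℂ ↥(highestWeightSpace (coordRep (MatIdx 3) ℂ 3)
            (Weight.dualOfPartition (3 * 3) lmrPartitionThree).toMatIdx ⊓
          (orbitVanishingIdeal (detFormLex ℂ 3) 3).restrictScalars ℂ) = 1 :=
  detThree_lmr_exact_of_LMR LMR2013_detThree_idealHwv_holds plethysmCoeff_lmrPartitionThree_le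

/-- **`mult_{λ^*} ℂ[Δ(det₃)]₁₂ = 5`, unconditionally** (`λ = (19,7,2^5)`). Instance of
`orbitMultiplicity_detThree_lmr_eq_five_of_LMR`. [cite: LandsbergManivelRessayre2013, §3.2 (p. 476)] -/
theorem orbitMultiplicity_detThree_lmr_eq_five :
    orbitMultiplicity ℂ (detFormLex ℂ 3) 3
        (Weight.dualOfPartition (3 * 3) lmrPartitionThree).toMatIdx = 5 :=
  orbitMultiplicity_detThree_lmr_eq_five_of_LMR LMR2013_detThree_idealHwv_holds
    plethysmCoeff_lmrPartitionThree_le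

/-- **`mult_{λ^*} ℂ[Δ(per₃)]₁₂ = 6`, unconditionally** (`λ = (19,7,2^5)`); first conjunct of
`perThree_lmr_exact`, isolated for citation. [cite: LandsbergManivelRessayre2013, §3.2 (p. 476)] -/
theorem orbitMultiplicity_perThree_lmr_eq_six :
    orbitMultiplicity ℂ (paddedPerFormLex ℂ 3 3) 3
        (Weight.dualOfPartition (3 * 3) lmrPartitionThree).toMatIdx = 6 :=
  perThree_lmr_exact.1

/-- **The complete LMR row, both sides, unconditionally**: `mult_{λ^*} ℂ[Δ(det₃)]₁₂ + 1 = a_λ(12[3])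
≤ mult_{λ^*} ℂ[Δ(per₃)]₁₂` and `PerDetMultiplicityObstructionAt 3 3 12 λ` — a multiplicity obstruction
of type `λ = (19,7,2^5)` in degree 12 for `per₃` versus `Δ(det₃)` (the separation itself is classical;
the datum is the representation-theoretic one). Instance of `perDet_lmr_exact_of_LMR`.
[cite: LandsbergManivelRessayre2013, §3.2 (p. 476)] -/
theorem perDet_lmr_exact :
    orbitMultiplicity ℂ (detFormLex ℂ 3) 3 (Weight.dualOfPartition (3 * 3) lmrPartitionThree).toMatIdx + 1 =
        plethysmCoeff ℂ (MatIdx 3) 3 (Weight.dualOfPartition (3 * 3) lmrPartitionThree).toMatIdx ∧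
      plethysmCoeff ℂ (MatIdx 3) 3 (Weight.dualOfPartition (3 * 3) lmrPartitionThree).toMatIdx ≤
        orbitMultiplicity ℂ (paddedPerFormLex ℂ 3 3) 3
          (Weight.dualOfPartition (3 * 3) lmrPartitionThree).toMatIdx ∧
      PerDetMultiplicityObstructionAt (k := ℂ) 3 3 12 lmrPartitionThree :=
  perDet_lmr_exact_of_LMR LMR2013_detThree_idealHwv_holds plethysmCoeff_lmrPartitionThree_le

/-- **Numerical summary, unconditionally**: `mult_{λ^*} ℂ[Δ(det₃)]₁₂ = 5` and
`mult_{λ^*} ℂ[Δ(per₃)]₁₂ = 6`. Instance of `perDet_lmr_five_six_of_LMR`.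
[cite: LandsbergManivelRessayre2013, §3.2 (p. 476)] -/
theorem perDet_lmr_five_six :
    orbitMultiplicity ℂ (detFormLex ℂ 3) 3 (Weight.dualOfPartition (3 * 3) lmrPartitionThree).toMatIdx = 5 ∧
      orbitMultiplicity ℂ (paddedPerFormLex ℂ 3 3) 3
        (Weight.dualOfPartition (3 * 3) lmrPartitionThree).toMatIdx = 6 :=
  perDet_lmr_five_six_of_LMR LMR2013_detThree_idealHwv_holds plethysmCoeff_lmrPartitionThree_le

/-- **The `(3,3)` LMR row of record in one conjunction** (`λ = (19,7,2^5) ⊢ 36`, degree 12, all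
hypothesis-free): `mult_det = 5`, `mult_per = 6`, `a_λ(12[3]) = 6`, exactly one copy of `S_{λ^*}` in
`I(Δ(det₃))₁₂`, none in `I(Δ(per₃))₁₂`, and `PerDetMultiplicityObstructionAt 3 3 12 λ`.
[cite: LandsbergManivelRessayre2013, Thm. 1.1.2 (1) (p. 470) and §3.2 (p. 476)] -/
theorem lmr_threeThree_row :
    orbitMultiplicity ℂ (detFormLex ℂ 3) 3 (Weight.dualOfPartition (3 * 3) lmrPartitionThree).toMatIdx = 5 ∧
      orbitMultiplicity ℂ (paddedPerFormLex ℂ 3 3) 3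
          (Weight.dualOfPartition (3 * 3) lmrPartitionThree).toMatIdx = 6 ∧
      plethysmCoeff ℂ (MatIdx 3) 3 (Weight.dualOfPartition (3 * 3) lmrPartitionThree).toMatIdx = 6 ∧
      Module.finrank ℂ ↥(highestWeightSpace (coordRep (MatIdx 3) ℂ 3)
            (Weight.dualOfPartition (3 * 3) lmrPartitionThree).toMatIdx ⊓
          (orbitVanishingIdeal (detFormLex ℂ 3) 3).restrictScalars ℂ) = 1 ∧
      Module.finrank ℂ ↥(highestWeightSpace (coordRep (MatIdx 3) ℂ 3)
            (Weight.dualOfPartition (3 * 3) lmrPartitionThree).toMatIdx ⊓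
          (orbitVanishingIdeal (paddedPerFormLex ℂ 3 3) 3).restrictScalars ℂ) = 0 ∧
      PerDetMultiplicityObstructionAt (k := ℂ) 3 3 12 lmrPartitionThree :=
  ⟨orbitMultiplicity_detThree_lmr_eq_five, perThree_lmr_exact.1, perThree_lmr_exact.2.1,
    detThree_lmr_exact.2, perThree_lmr_exact.2.2, perDet_lmr_exact.2.2⟩

end Summit.PneNP.GCT
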